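import Summits.CriticalPhenomena.Ising3DConformalLimit.Theorems.SynchronousCouplingDefs

/-!
# Line `SketchIdeator2` for the crux `SynchronousCoupling.RotationJoining` (stmt-CriticalPhenomena-18763) —
sub-goal `stub_axis3OfDilationJoinings`

Bookkeeping only: the route's crux `DilationJoinings` (stmt-CriticalPhenomena-18762, `p ∈ {2, 3}`) specialised to
`p = 3` is, verbatim up to the identities `((3 * b : ℕ) : ℤ) = 3 * b`, `axisCell n 0 = [0, n)³` and
`axisCell (3 b) u = ∏ᵢ [3 b uᵢ, 3 b uᵢ + 3 b)`, the statement `DilationJoiningsAxis3` of the line's vocabulary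
(`normAxis`, `blockSum`, `axisCell` of `Theorems/SynchronousCouplingDefs`). No probability content.

Helper file of the line `SketchIdeator2` (lead skeleton `Cruxes/RotationJoining/Lines/SketchIdeator2.lean`): proves
the registered stub `stub_axis3OfDilationJoinings : Sig.stub_axis3OfDilationJoinings` verbatim (name + signature).
No definitions, no named facts, no sorry.
-/

namespace Summit.CriticalPhenomena.Ising3DConformalLimit.Cruxes.RotationJoining.RateSplitting

open MeasureTheory Literature.Probability.LatticeModels

/-- The axis cell of side `p * b` at `u` in the route's spelling: `∏ᵢ [p b uᵢ, p b uᵢ + p b)`. -/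
private theorem axisCell_mul (p b : ℕ) (u : Fin 3 → ℤ) :
    axisCell (p * b) u =
      Fintype.piFinset (fun i : Fin 3 => Finset.Ico ((p : ℤ) * b * u i) ((p : ℤ) * b * u i + (p : ℤ) * b)) := by
  unfold axisCell
  push_cast
  rfl

/-- The axis cell of side `p * b` at the origin in the route's spelling: `[0, p b)³`. -/
private theorem axisCell_mul_zero (p b : ℕ) :
    axisCell (p * b) 0 = Fintype.piFinset (fun _ : Fin 3 => Finset.Ico (0 : ℤ) ((p : ℤ) * b)) := by
  unfold axisCell
  push_cast
  simp

/-- The axis cell of side `b` at the origin in the route's spelling: `[0, b)³`. -/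
private theorem axisCell_zero (b : ℕ) :
    axisCell b 0 = Fintype.piFinset (fun _ : Fin 3 => Finset.Ico (0 : ℤ) (b : ℤ)) := by
  unfold axisCell
  simp

/-- **Sub-goal `stub_axis3OfDilationJoinings`.** The route's crux `DilationJoinings` (item
stmt-CriticalPhenomena-18762) gives `DilationJoiningsAxis3`, its `p = 3` instance in the line's vocabulary. -/
theorem stub_axis3OfDilationJoinings : Sig.stub_axis3OfDilationJoinings := by
  intro hDJ μ hμ hTI
  obtain ⟨C, θ, hθ, h⟩ := hDJ μ hμ hTI 3 (Or.inr rfl)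
  refine ⟨C, θ, hθ, fun b m hb => ?_⟩
  obtain ⟨π, h1, h2, h3⟩ := h b m hb
  refine ⟨π, h1, h2, fun u hu => ?_⟩
  have key := h3 u hu
  unfold normAxis blockSum
  rw [axisCell_mul_zero 3 b, axisCell_mul 3 b u, axisCell_zero b, axisCell]
  exact key

end Summit.CriticalPhenomena.Ising3DConformalLimit.Cruxes.RotationJoining.RateSplitting
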